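import Summits.ResolutionOfSingularities.ResolutionOfSingularities.Theses.FrobeniusLadder
import Literature.RingTheory.TightClosure.RegularTightlyClosed
import Literature.RingTheory.RegularLocalRing.SopRegular

/-!
# Route FrobeniusLadder — support item `RegularStalksClimb` (stmt-ResolutionOfSingularities-15334)

FAITHFULNESS of the ladder: regular local rings sit on its top rung. For every prime `p` and every
Noetherian regular local ring `(R, 𝔪)` of characteristic `p`, every system of parameters
`s : Fin d → R` (`d = dim R`, `rad (s)` maximal) is a (weakly) regular sequence, and the ideal `(s)`
is tightly closed in the inline form of the route
(`c ≠ 0 ∧ (∀ e, c·y^(p^e) ∈ (s)^[p^e]) ⇒ y ∈ (s)`).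

Both halves are theorems of the tree's Literature and this file only assembles them:

* `Literature.RingTheory.RegularLocalRing.isRegular_of_maximalIdeal_pow_le_ofList` — in a regular
  local ring a system of parameters is a regular sequence (Matsumura, *Commutative Ring Theory*,
  Thm. 17.4 (iii) with Thm. 17.8), fed with `𝔪ᴺ ⊆ (s)` (`Ideal.exists_pow_le_of_le_radical_of_fg`,
  `𝔪` finitely generated) and `Ideal.ofList (List.ofFn s) = Ideal.span (Set.range s)`;
* `Literature.RingTheory.TightClosure.isFRational_of_isRegularLocalRing` — every parameter ideal of
  a regular local ring of characteristic `p` is tightly closed (Hochster–Huneke 1990, Thm. 4.4;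
  Huneke–Swanson Thm. 13.1.2 (6); via Kunz's flatness of Frobenius, `(I^[q] : x^q) = (I : x)^[q]`
  and Krull's intersection theorem), unfolded to the route's inline clause by
  `isFRational_iff_of_isDomain` (a regular local ring is a domain, Matsumura Thm. 14.3,
  `isDomain_of_isRegularLocalRing`).
-/

-- single-problem summit: the doubled namespace component `ResolutionOfSingularities` is forced
set_option linter.dupNamespace false

namespace Summit.ResolutionOfSingularities.ResolutionOfSingularities.Theorems

open IsLocalRing Literature.RingTheory.TightClosure Literature.RingTheory.RegularLocalRing
  Literature.AlgebraicGeometry.Resolution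

/-- **Support item `RegularStalksClimb` of route FrobeniusLadder**
(stmt-ResolutionOfSingularities-15334): for every prime `p` and every Noetherian regular local ring
`R` of characteristic `p`, if `dim R = d` and `s : Fin d → R` generates an ideal with maximal
radical (a system of parameters), then `s` is a weakly regular sequence on `R` and the ideal `(s)`
is tightly closed: `c ≠ 0` and `c·y^(p^e) ∈ span {z^(p^e) | z ∈ (s)}` for all `e` force
`y ∈ (s)`. Proof: Matsumura Thm. 17.4 (iii)/17.8 (regular ⇒ every s.o.p. is a regular sequence,
`isRegular_of_maximalIdeal_pow_le_ofList`) and Hochster–Huneke Thm. 4.4 (every ideal of a regular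
local ring of characteristic `p` is tightly closed, `isFRational_of_isRegularLocalRing`, through
Kunz's theorem). [cite: Matsumura1987, Thm. 17.4 (iii); HochsterHuneke1990, Thm. 4.4] -/
theorem RegularStalksClimb_proof :
    Summit.ResolutionOfSingularities.ResolutionOfSingularities.Theses.FrobeniusLadder.RegularStalksClimb := by
  unfold Summit.ResolutionOfSingularities.ResolutionOfSingularities.Theses.FrobeniusLadder.RegularStalksClimb
  intro p hp R _ _ _ _ hR d hd s hs
  haveI : Fact p.Prime := ⟨hp⟩
  haveI : IsRegularLocalRing R := hR
  haveI : IsDomain R := isDomain_of_isRegularLocalRing R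
  refine ⟨?_, (isFRational_iff_of_isDomain p).mp (isFRational_of_isRegularLocalRing p R) d hd s hs⟩
  -- the system of parameters `s` is a regular sequence
  have hrad : (Ideal.span (Set.range s)).radical = maximalIdeal R := IsLocalRing.eq_maximalIdeal hs
  have hIm : Ideal.span (Set.range s) ≤ maximalIdeal R := Ideal.le_radical.trans hrad.le
  have hofList : Ideal.ofList (List.ofFn s) = Ideal.span (Set.range s) := by
    change Ideal.span {r | r ∈ List.ofFn s} = Ideal.span (Set.range s)
    congr 1
    ext r
    rw [Set.mem_setOf_eq, List.mem_ofFn']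
  obtain ⟨N, hN⟩ := Ideal.exists_pow_le_of_le_radical_of_fg hrad.ge
    (IsNoetherian.noetherian (maximalIdeal R))
  have hreg : RingTheory.Sequence.IsRegular R (List.ofFn s) :=
    isRegular_of_maximalIdeal_pow_le_ofList (R := R) (Q := List.ofFn s)
      (fun q hq => hIm (Ideal.subset_span ((List.mem_ofFn' s q).mp hq)))
      (by rw [List.length_ofFn, hd]) (N := N) (by rwa [hofList])
  exact hreg.toIsWeaklyRegular

end Summit.ResolutionOfSingularities.ResolutionOfSingularities.Theorems
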